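import Summits.ValiantsHypothesis.ValiantsHypothesis.Theorems.LacunarySymmetroidMatrixDescartesGraftLaw
import Summits.ValiantsHypothesis.ValiantsHypothesis.Theorems.LacunarySymmetroidMatrixDescartesKFourColumnTwoSided

/-!
# `MatrixDescartes` census — THE ALL-FORMAT FLOOR `ζ_sym(m,K) ≥ m² + (K−2)·m` (`m ≥ 1`, `K ≥ 4`)

HONEST FRAMING.  Object-search cell `pub-symmetroid`, crux `Theses.LacunarySymmetroid.MatrixDescartes`
(stmt-ValiantsHypothesis-18050); seat val-sym-mdr-p1 (g3).  LOWER-bound / construction statement in census (CONJECTURE-A) currency;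
nothing about the crux `MatrixDescartes` (an upper bound at fat formats), `DoorA26` / `DoorA34`, or `VP ≠ VNP`.  No definitions.

The seat's two-sided Lagrange tower (`LagrangeTower.exists_D_alternating4`, g2: the cell's P4, `m² + 2m` alternations with FOUR letters,
every `m ≥ 1`) put in alternation-certificate form (`exists_alternating_four`) and grafted `K − 4` times by the GRAFT LAW
(`Graft.exists_alternating_add`: each further letter buys `m` further alternations):
**`not_posRootLawAt_graft (m K) (1 ≤ m) (4 ≤ K) : ¬ PosRootLawAt m K (m² + (K−2)·m − 1)`** — some real symmetric `K`-term `m × m`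
lacunary pencil has `m² + (K−2)·m` distinct positive determinant roots.  `K = 4` is P4 itself (`LagrangeTower.not_posRootLawAt_four`),
`K = 5` the cell's «natural graft» `m² + 3m` (`HOME/val-sym-mdr-p1/g2/LADDER-IN-THE-KERNEL.md` §3), and numeral instances
`(5,5) ≥ 40`, `(6,5) ≥ 54`, `(7,5) ≥ 70`, `(8,5) ≥ 88`, `(10,5) ≥ 130`, `(5,6) ≥ 45`, `(6,6) ≥ 60`.  Below the cell's certified records
wherever those exist (thin formats); new kernel rows elsewhere.  [folklore]
-/

-- `Summit.ValiantsHypothesis.ValiantsHypothesis.…` repeats a component by the D-0017 layout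
-- (single-conjunct summit), which the `dupNamespace` linter flags; the name is mandated.
set_option linter.dupNamespace false

namespace Summit.ValiantsHypothesis.ValiantsHypothesis.Theorems.LacunarySymmetroidMatrixDescartes.Census.Graft

open Matrix Finset Filter Topology
open scoped BigOperators
open Summit.ValiantsHypothesis.ValiantsHypothesis.Theorems.MatrixDescartes.Negative (PosRootLawAt)

open LagrangeTower in
/-- **The `K = 4` base in alternation form**: the seat's two-sided Lagrange tower (`LagrangeTower.exists_D_alternating4`, the cell's P4)
has `(m+1)² − 1 = m² + 2m` alternations along `(m+1)²` positive test points, for every `m ≥ 1`. [folklore] -/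
theorem exists_alternating_four (m : ℕ) (hm : 1 ≤ m) :
    ∃ (d : Fin 4 → ℕ) (S : Fin 4 → Matrix (Fin m) (Fin m) ℝ) (τ : Fin ((m + 1) ^ 2 - 1 + 1) → ℝ),
      (∀ l, (S l).IsSymm) ∧ StrictMono τ ∧ (∀ j, 0 < τ j) ∧ (∀ j, (∑ l, τ j ^ d l • S l).det ≠ 0) ∧
      ∀ j : Fin ((m + 1) ^ 2 - 1),
        (∑ l, τ j.castSucc ^ d l • S l).det * (∑ l, τ j.succ ^ d l • S l).det < 0 := by
  obtain ⟨D, hD⟩ := exists_D_alternating4 m hm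
  have hsq := tri_add_tri_succ m
  refine alternating_transport (N₁ := tri m + tri (m + 1) - 1) (by rw [hsq]) ?_
  set N := tri m + tri (m + 1) - 1 with hN
  have hN2 : 2 ≤ tri m + tri (m + 1) := by rw [hsq]; nlinarith
  let τ : Fin (N + 1) → ℝ := fun i => cpts m i
  have hτ : StrictMono τ := by
    refine Fin.strictMono_iff_lt_succ.mpr fun i => ?_
    show cpts m (Fin.castSucc i) < cpts m i.succ
    rw [Fin.val_castSucc, Fin.val_succ]
    exact cpts_lt_succ m i hm (by omega)
  have hτpos : ∀ i, 0 < τ i := fun i => cpts_pos m i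
  have heval : ∀ t : ℝ, 0 < t →
      (∑ l, t ^ witness4Exps D l • witness4Letters m D l).det = (t ^ D) ^ m * (Gmat m D t).det := by
    intro t ht
    rw [pencil4_eq_smul_Gmat m D ht.ne', Matrix.det_smul, Fintype.card_fin]
  have halt : ∀ j : Fin N, (∑ l, τ j.castSucc ^ witness4Exps D l • witness4Letters m D l).det *
      (∑ l, τ j.succ ^ witness4Exps D l • witness4Letters m D l).det < 0 := by
    intro j
    show (∑ l, cpts m (Fin.castSucc j) ^ witness4Exps D l • witness4Letters m D l).det *
      (∑ l, cpts m j.succ ^ witness4Exps D l • witness4Letters m D l).det < 0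
    rw [Fin.val_castSucc, Fin.val_succ, heval _ (cpts_pos m j), heval _ (cpts_pos m (j + 1))]
    have hneg := hD j (by omega)
    have h1 : 0 < (cpts m j ^ D) ^ m := by have := cpts_pos m j; positivity
    have h2 : 0 < (cpts m (j + 1) ^ D) ^ m := by have := cpts_pos m (j + 1); positivity
    have : (cpts m ↑j ^ D) ^ m * (Gmat m D (cpts m ↑j)).det *
        ((cpts m (↑j + 1) ^ D) ^ m * (Gmat m D (cpts m (↑j + 1))).det)
        = ((cpts m ↑j ^ D) ^ m * (cpts m (↑j + 1) ^ D) ^ m) *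
          ((Gmat m D (cpts m ↑j)).det * (Gmat m D (cpts m (↑j + 1))).det) := by ring
    rw [this]
    exact mul_neg_of_pos_of_neg (mul_pos h1 h2) hneg
  exact ⟨witness4Exps D, witness4Letters m D, τ, witness4Letters_isSymm m D, hτ, hτpos,
    ne_zero_of_alternating (by omega) _ halt, halt⟩

/-- **THE ALL-FORMAT FLOOR: `ζ_sym(m,K) ≥ m² + (K−2)·m` for every `m ≥ 1`, `K ≥ 4`** — `¬ PosRootLawAt m K (m² + (K−2)·m − 1)`: some real
symmetric `K`-term `m × m` lacunary pencil has `m² + (K−2)·m` distinct positive determinant roots (the P4 tower grafted `K − 4` times).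
At `K = 4` this is P4 (`LagrangeTower.not_posRootLawAt_four`); at `K = 5` the cell's «natural graft» `m² + 3m`. A LOWER bound in census
currency — nothing about the crux `MatrixDescartes`. [folklore] -/
theorem not_posRootLawAt_graft (m K : ℕ) (hm : 1 ≤ m) (hK : 4 ≤ K) :
    ¬ PosRootLawAt m K (m ^ 2 + (K - 2) * m - 1) := by
  obtain ⟨j, rfl⟩ := Nat.exists_eq_add_of_le hK
  rw [show 4 + j - 2 = j + 2 by omega]
  have h := exists_alternating_add (exists_alternating_four m hm) j
  have hN : (m + 1) ^ 2 - 1 + j * m = m ^ 2 + (j + 2) * m := by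
    rw [show (m + 1) ^ 2 = m ^ 2 + 2 * m + 1 by ring, Nat.add_sub_cancel]
    ring
  obtain ⟨d, S, τ, hS, hτ, hpos, -, halt⟩ := alternating_transport hN h
  exact not_posRootLawAt_of_alternating (by nlinarith) d S hS τ hτ hpos halt

/-- **`K = 5` for every `m`** (the cell's natural graft, LADDER-IN-THE-KERNEL §3): `ζ_sym(m,5) ≥ m² + 3m`. [folklore] -/
theorem not_posRootLawAt_five (m : ℕ) (hm : 1 ≤ m) : ¬ PosRootLawAt m 5 (m ^ 2 + 3 * m - 1) :=
  not_posRootLawAt_graft m 5 hm (by norm_num)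

/-- **`K = 6` for every `m`**: `ζ_sym(m,6) ≥ m² + 4m`. [folklore] -/
theorem not_posRootLawAt_six (m : ℕ) (hm : 1 ≤ m) : ¬ PosRootLawAt m 6 (m ^ 2 + 4 * m - 1) :=
  not_posRootLawAt_graft m 6 hm (by norm_num)

/-- **Certificate ⇒ grafted rows (for the census generator).**  Same hypotheses as the tree's
`Census.not_posRootLawAt_of_certificate` (closed form `q` of `det F(t)`, symmetric letters, strictly increasing positive test points,
strict sign alternation of `q` along them, `N ≥ 1` alternations) — conclusion for EVERY `j`: `¬ PosRootLawAt m (K + j) (N + j·m − 1)`,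
i.e. the certified row grafted `j` times (`+m` roots per extra letter).  A census certificate file obtains its whole rightward RAY of rows
by replacing the final lemma. [folklore] -/
theorem not_posRootLawAt_add_of_certificate {m K N : ℕ} {d : Fin K → ℕ}
    {S : Fin K → Matrix (Fin m) (Fin m) ℝ} {q : ℝ → ℝ}
    (hq : ∀ t : ℝ, (∑ l, t ^ d l • S l).det = q t) (hS : ∀ l, (S l).IsSymm)
    (τ : Fin (N + 1) → ℝ) (hτ : StrictMono τ) (hpos : ∀ j, 0 < τ j)
    (halt : ∀ j : Fin N, q (τ j.castSucc) * q (τ j.succ) < 0) (hN : 1 ≤ N) (j : ℕ) :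
    ¬ PosRootLawAt m (K + j) (N + j * m - 1) := by
  have halt' : ∀ i : Fin N,
      (∑ l, τ i.castSucc ^ d l • S l).det * (∑ l, τ i.succ ^ d l • S l).det < 0 := fun i => by
    rw [hq, hq]; exact halt i
  have hne : ∀ i, (∑ l, τ i ^ d l • S l).det ≠ 0 :=
    ne_zero_of_alternating hN (fun i => (∑ l, τ i ^ d l • S l).det) halt'
  obtain ⟨d', S', τ', hS', hτ', hpos', -, halt''⟩ :=
    exists_alternating_add ⟨d, S, τ, hS, hτ, hpos, hne, halt'⟩ j
  exact not_posRootLawAt_of_alternating (hN.trans (Nat.le_add_right N (j * m))) d' S' hS' τ' hτ' hpos' halt''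

/-! ### Numeral rows (instances; census format `(m,K) ≥ B + 1` reads `¬ PosRootLawAt m K B`) -/

/-- `ζ_sym(5,5) ≥ 40`. [folklore] -/
theorem row_5_5 : ¬ PosRootLawAt 5 5 39 := not_posRootLawAt_graft 5 5 (by norm_num) (by norm_num)

/-- `ζ_sym(6,5) ≥ 54`. [folklore] -/
theorem row_6_5 : ¬ PosRootLawAt 6 5 53 := not_posRootLawAt_graft 6 5 (by norm_num) (by norm_num)

/-- `ζ_sym(7,5) ≥ 70`. [folklore] -/
theorem row_7_5 : ¬ PosRootLawAt 7 5 69 := not_posRootLawAt_graft 7 5 (by norm_num) (by norm_num)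

/-- `ζ_sym(8,5) ≥ 88`. [folklore] -/
theorem row_8_5 : ¬ PosRootLawAt 8 5 87 := not_posRootLawAt_graft 8 5 (by norm_num) (by norm_num)

/-- `ζ_sym(5,6) ≥ 45`. [folklore] -/
theorem row_5_6 : ¬ PosRootLawAt 5 6 44 := not_posRootLawAt_graft 5 6 (by norm_num) (by norm_num)

/-- `ζ_sym(6,6) ≥ 60`. [folklore] -/
theorem row_6_6 : ¬ PosRootLawAt 6 6 59 := not_posRootLawAt_graft 6 6 (by norm_num) (by norm_num)

/-- `ζ_sym(10,5) ≥ 130`. [folklore] -/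
theorem row_10_5 : ¬ PosRootLawAt 10 5 129 := not_posRootLawAt_graft 10 5 (by norm_num) (by norm_num)

end Summit.ValiantsHypothesis.ValiantsHypothesis.Theorems.LacunarySymmetroidMatrixDescartes.Census.Graft
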